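import Mathlib
import Summits.ResolutionOfSingularities.ResolutionOfSingularities.Theorems.HomologicalConductorNoZenoAnnihilatorLemmaL
import Literature.AlgebraicGeometry.Resolution.ExceptionalFibreConnected
import Literature.AlgebraicGeometry.Resolution.ResolutionFibreDimension
import Literature.AlgebraicGeometry.Morphisms.CechH2FibreDimOne
import HarnessLib

/-!
# Route `HomologicalConductor`, crux `NoZenoR` (stmt-ResolutionOfSingularities-19943; twin `NoZeno`
# stmt-16483), S3 G-layer — G1 = LEMMA L with its side conditions DISCHARGED, in the shape consumed by
# the Ga assembly `caCarried_tower_of_inputs` (hypothesis `hL`)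

OURS (cell res-hironaka, crux chain W4.4, seat res-L0-w44-stub-2). Nothing here is a statement of the
manuscript under review (Hironaka 2017); AI-written, weaker than expert review.

`lemmaL_of_GW`: for a Noetherian local NORMAL domain `T` of Krull dimension `2` which is not regular,
a resolution `π : X → Spec T`, an affine-localizing `𝒪_X`-module `F`, a finite affine open cover `𝒰`
and `𝔪ᶜ ≤ 𝔞 := ann_T Ȟ¹(𝒰, F)`: if for every maximal point `η` of the closed fibre some non-zero
`a ∈ 𝔞` has `ord_η a ≤ ord_η t`, then `t ∈ 𝔞` — modulo ONLY the named fact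
`Morphisms.GortzWedhorn2023_24_44_H2` (Görtz–Wedhorn II Cor. 24.44, `H² = 0` above the fibre
dimension), i.e. exactly the binder `hL` of the lead's `caCarried_tower_of_inputs`
(`…NoZenoCaCarriedTower`) with `T := ↥(tower O A m)`. The inputs of
`LemmaL.annihilator_cechMH1_isCarried_coheight` are discharged by the tree: right exactness `hRE` by
`GortzWedhorn2023_24_44_H2.cechMapH1_surjective` + `IsResolution.topologicalKrullDim_fiber_le_one`
(res-D-pv-039, res-L0-w44-stub-4), injectivity of `T → K(X)` by `IsResolution.isIso_appTop`
(res-L0-w44-stub-3, Zariski) + integrality, and the dictionary «codimension-one points of the closed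
fibre are exceptional curves, hence maximal points of the fibre» by
`IsResolution.mem_excCurvePoints_of_coheight_eq_one` / `excCurvePoints_subset_excPoints`
(res-L0-w44-stub-3 and -stub-4). References: as in `…NoZenoAnnihilatorLemmaL`.
-/

noncomputable section

-- single-problem summit: the doubled namespace component `ResolutionOfSingularities` is forced
set_option linter.dupNamespace false

open CategoryTheory CategoryTheory.Limits AlgebraicGeometry TopologicalSpace Opposite IsLocalRing
open Literature.AlgebraicGeometry.Resolution Literature.AlgebraicGeometry.Morphisms
open Literature.AlgebraicGeometry.Modules

namespace Summit.ResolutionOfSingularities.ResolutionOfSingularities.Theorems.NoZeno.SandwichCluster.LemmaL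

variable {T : Type} [CommRing T] [IsNoetherianRing T] [IsLocalRing T] [IsDomain T] [IsIntegrallyClosed T]
  {X : Scheme.{0}} [IsIntegral X] [IsLocallyNoetherian X] (π : X ⟶ Spec (.of T))

omit [IsLocalRing T] [IsLocallyNoetherian X] in
/-- `T → K(X)` is injective for a resolution of a normal domain (`Γ(X, 𝒪_X) = T` and `X` integral).
[folklore] -/
theorem baseToFunctionField_injective (hπ : IsResolution π) :
    Function.Injective (baseToFunctionField π) := by
  haveI := hπ.isIso_appTop
  change Function.Injective ((X.presheaf.germ ⊤ (genericPoint X) trivial).hom.comp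
    (π.appTop.hom.comp (Scheme.ΓSpecIso (.of T)).inv.hom))
  rw [RingHom.coe_comp, RingHom.coe_comp]
  refine (germ_injective_of_isIntegral X (U := ⊤) (genericPoint X) trivial).comp
    (Function.Injective.comp ?_ ?_)
  · exact (ConcreteCategory.bijective_of_isIso π.appTop).1
  · exact (ConcreteCategory.bijective_of_isIso (Scheme.ΓSpecIso (.of T)).inv).1

/-- **LEMMA L, side conditions discharged (modulo Görtz–Wedhorn II Cor. 24.44)** — the binder `hL` of
`caCarried_tower_of_inputs`: for `T` a Noetherian local normal domain of Krull dimension `2`, not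
regular, `π : X → Spec T` a resolution, `F` affine-localizing, `𝒰` a finite affine open cover and
`𝔪ᶜ ≤ 𝔞 = ann_T Ȟ¹(𝒰, F)`: if at every maximal point `η` of the closed fibre some non-zero `a ∈ 𝔞`
has `ord_η a ≤ ord_η t`, then `t ∈ 𝔞`. OURS (Q-rat Lemma A (A4)). [folklore] -/
theorem lemmaL_of_GW (hGW : GortzWedhorn2023_24_44_H2.{0}) (hπ : IsResolution π)
    (h2 : ringKrullDim T = 2) (hsing : ¬ IsRegularLocalRing T)
    (F : X.Modules) (hF : IsAffineLocalizing F) (ι : Type) [Finite ι] (U : ι → X.Opens)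
    (hUaff : ∀ i, IsAffineOpen (U i)) (hUcov : ⨆ i, U i = ⊤)
    (c : ℕ) (hc : maximalIdeal T ^ c ≤ Module.annihilator T (CechMH1 π F U)) (t : T)
    (ht : ∀ η ∈ excPoints π, ∃ a ∈ Module.annihilator T (CechMH1 π F U),
      a ≠ 0 ∧ Scheme.ord (baseToFunctionField π a) η ≤ Scheme.ord (baseToFunctionField π t) η) :
    t ∈ Module.annihilator T (CechMH1 π F U) := by
  haveI : IsProper π := hπ.isProper
  have hRE : ∀ S : ShortComplex X.Modules, S.ShortExact → IsAffineLocalizing S.X₁ →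
      Function.Surjective (cechMapH1 π S.g U) := fun S hS h₁ =>
    hGW.cechMapH1_surjective π U (hπ.topologicalKrullDim_fiber_le_one h2.le) hS h₁ hUaff hUcov
  obtain ⟨Z, hZ⟩ := annihilator_cechMH1_isCarried_coheight π hπ h2
    (baseToFunctionField_injective π hπ) F hF U hUaff hRE hc
  refine (hZ t).mpr ?_
  by_cases ht0 : t = 0
  · exact Or.inl ht0
  refine Or.inr fun ζ hζ𝔪 hζ => ?_
  have hζexc : ζ ∈ excPoints π :=
    hπ.excCurvePoints_subset_excPoints h2 (hπ.mem_excCurvePoints_of_coheight_eq_one h2 hsing hζ𝔪 hζ)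
  obtain ⟨a, ha𝔞, ha0, hle⟩ := ht ζ hζexc
  rcases (hZ a).mp ha𝔞 with h | h
  · exact absurd h ha0
  · exact (h ζ hζ𝔪 hζ).trans hle

end Summit.ResolutionOfSingularities.ResolutionOfSingularities.Theorems.NoZeno.SandwichCluster.LemmaL

end
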